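import Mathlib
import Summits.AtomisticToContinuum.FouriersLaw.Theses.EmbeddedDrudeMourre
import Summits.AtomisticToContinuum.FouriersLaw.Theorems.EmbeddedDrudeMourreKineticConductivityFiniteFormDomain
import Summits.AtomisticToContinuum.FouriersLaw.Theorems.EmbeddedDrudeMourreKineticConductivityFiniteMeasurable
import HarnessLib

/-!
# `EmbeddedDrudeMourre.KineticConductivityFinite` — proved

Item `stmt-AtomisticToContinuum-12599` (support, rank 9, route `EmbeddedDrudeMourre`, sub-problem
`FouriersLaw`): for `ω₂, a, b, T > 0`,

  `HasOddSectorGap ω₂ a b → 0 < kineticConductivity ω₂ a b T ∧ kineticConductivity ω₂ a b T < ⊤`,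

`kineticConductivity = (2πT²)⁻¹ · inverseForm (currentVector)` being ALS's phonon-Boltzmann
prediction `T⁻²⟨ω⁻²g, L⁻¹ω⁻²g⟩` for the conductivity of the pinned anharmonic chain
(Aoki–Lukkarinen–Spohn 2006, (3.22)–(3.23)).

* POSITIVITY (companion file `…FormDomain`, no gap needed): the trial function `sin` has finite
  form because on the non-trivial resonant branch its bracket is an exact multiple of the
  resolved-delta Jacobian (`sin_bracket_identity`, file `…Algebra`), and it overlaps the current.
* FINITENESS (this file): for `f` in the form domain, the pairing with the ODD current only sees
  the odd part `f_o = (f - f(-·))/2` (`cellPairing_oddPart`), `q(f_o) ≤ q(f)` by momentum-reversal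
  invariance and convexity (`boltzmannForm_oddPart_le`, file `…Measurable`), and the gap
  `g‖f_o‖² ≤ q(f_o)` gives `2⟨φ, f⟩ - q(f) ≤ ‖φ‖²/g + g‖f_o‖² - q(f) ≤ ‖φ‖²/g` (`sub_le_of_gap`);
  hence `inverseForm φ ≤ ‖φ‖²/g < ∞`.

The closing theorem is `kineticConductivityFinite_proof`.
-/

noncomputable section

open Real Set MeasureTheory
open scoped ENNReal

namespace Summit.AtomisticToContinuum.FouriersLaw.Theorems.KineticConductivityFinite

open Literature.MathematicalPhysics.KineticTheory.PhononBoltzmann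

/-! ### 1. The odd part of a form-domain function -/

/-- `‖f(-·)‖² = ‖f‖²` on the cell. [folklore] -/
theorem cellNormSq_comp_neg (f : ℝ → ℝ) : cellNormSq (fun k => f (-k)) = cellNormSq f := by
  unfold cellNormSq
  exact setLIntegral_cell_neg (fun k => ENNReal.ofReal (f k ^ 2))

/-- `‖f_o‖² ≤ ‖f‖²` for the odd part `f_o = (f - f(-·))/2` of a measurable `f`. [folklore] -/
theorem cellNormSq_oddPart_le {f : ℝ → ℝ} (hf : Measurable f) :
    cellNormSq (fun k => (f k - f (-k)) / 2) ≤ cellNormSq f := by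
  unfold cellNormSq
  have hpt : ∀ k, ENNReal.ofReal (((f k - f (-k)) / 2) ^ 2) ≤
      ENNReal.ofReal (f k ^ 2 / 2) + ENNReal.ofReal (f (-k) ^ 2 / 2) := by
    intro k
    rw [← ENNReal.ofReal_add (by positivity) (by positivity)]
    apply ENNReal.ofReal_le_ofReal
    nlinarith [sq_nonneg (f k + f (-k))]
  have hm : Measurable fun k => ENNReal.ofReal (f k ^ 2 / 2) := by fun_prop
  calc ∫⁻ k in Ioc (-π) π, ENNReal.ofReal (((f k - f (-k)) / 2) ^ 2)
      ≤ ∫⁻ k in Ioc (-π) π, (ENNReal.ofReal (f k ^ 2 / 2) + ENNReal.ofReal (f (-k) ^ 2 / 2)) :=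
        lintegral_mono fun k => hpt k
    _ = (∫⁻ k in Ioc (-π) π, ENNReal.ofReal (f k ^ 2 / 2)) +
          ∫⁻ k in Ioc (-π) π, ENNReal.ofReal (f (-k) ^ 2 / 2) := lintegral_add_left hm _
    _ = (∫⁻ k in Ioc (-π) π, ENNReal.ofReal (f k ^ 2 / 2)) +
          ∫⁻ k in Ioc (-π) π, ENNReal.ofReal (f k ^ 2 / 2) := by
        rw [setLIntegral_cell_neg (fun k => ENNReal.ofReal (f k ^ 2 / 2))]
    _ = ∫⁻ k in Ioc (-π) π, ENNReal.ofReal (f k ^ 2) := by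
        rw [← two_mul, ← lintegral_const_mul' _ _ ENNReal.ofNat_ne_top]
        congr 1; funext k
        rw [show (2 : ℝ≥0∞) = ENNReal.ofReal 2 by simp, ← ENNReal.ofReal_mul zero_le_two]
        congr 1; ring

/-- The odd part of a `2π`-periodic function is `2π`-periodic. [folklore] -/
theorem oddPart_periodic {f : ℝ → ℝ} (hper : Function.Periodic f (2 * π)) :
    Function.Periodic (fun k => (f k - f (-k)) / 2) (2 * π) := by
  intro k
  simp only []
  rw [hper k, show -(k + 2 * π) = -k - 2 * π by ring, hper.sub_eq]

/-! ### 2. Pairing with the current: only the odd part counts -/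

/-- The current vector is measurable. [folklore] -/
theorem measurable_currentVector (ω₂ : ℝ) : Measurable (currentVector ω₂) := by
  unfold currentVector dispersion; fun_prop

/-- `|ω⁻² sin| ≤ 1/ω₂` (`|sin| ≤ 1`, `ω² ≥ ω₂`). [folklore] -/
theorem abs_currentVector_le {ω₂ : ℝ} (hω : 0 < ω₂) (k : ℝ) : |currentVector ω₂ k| ≤ 1 / ω₂ := by
  unfold currentVector
  rw [abs_div, abs_of_pos (pow_pos (dispersion_pos hω k) 2)]
  exact div_le_div₀ zero_le_one (Real.abs_sin_le_one k) hω (le_dispersion_sq hω.le k)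

/-- A square-integrable measurable `f` on the cell pairs integrably with the (bounded) current.
[folklore] -/
theorem integrableOn_currentVector_mul {ω₂ : ℝ} (hω : 0 < ω₂) {f : ℝ → ℝ} (hf : Measurable f)
    (hN : cellNormSq f < ⊤) :
    IntegrableOn (fun k => currentVector ω₂ k * f k) (Ioc (-π) π) := by
  have hf2 : IntegrableOn (fun k => f k ^ 2) (Ioc (-π) π) := by
    refine ⟨(hf.pow_const 2).aestronglyMeasurable, ?_⟩
    rw [hasFiniteIntegral_iff_ofReal (ae_of_all _ fun k => sq_nonneg (f k))]
    exact hN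
  have h1 : IntegrableOn (fun _ => (1 : ℝ)) (Ioc (-π) π) := continuous_const.integrableOn_Ioc
  have hg : IntegrableOn (fun k => (1 / ω₂) * ((1 + f k ^ 2) / 2)) (Ioc (-π) π) :=
    ((h1.add hf2).div_const 2).const_mul (1 / ω₂)
  refine Integrable.mono' hg (((measurable_currentVector ω₂).mul hf).aestronglyMeasurable)
    (ae_of_all _ fun k => ?_)
  rw [Real.norm_eq_abs, abs_mul]
  calc |currentVector ω₂ k| * |f k| ≤ (1 / ω₂) * |f k| :=
        mul_le_mul_of_nonneg_right (abs_currentVector_le hω k) (abs_nonneg _)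
    _ ≤ (1 / ω₂) * ((1 + f k ^ 2) / 2) := by
        apply mul_le_mul_of_nonneg_left _ (by positivity)
        nlinarith [abs_nonneg (f k), sq_abs (f k), sq_nonneg (|f k| - 1)]

/-- **Only the odd part pairs with the current**: `⟨ω⁻²g, f_o⟩ = ⟨ω⁻²g, f⟩` (the current is odd, so
`∫ φ (f + f(-·)) = 0` on the symmetric cell). [cite: Lukkarinen2016, §3.4] -/
theorem cellPairing_oddPart {ω₂ : ℝ} (hω : 0 < ω₂) {f : ℝ → ℝ} (hf : Measurable f)
    (hN : cellNormSq f < ⊤) :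
    cellPairing (currentVector ω₂) (fun k => (f k - f (-k)) / 2) =
      cellPairing (currentVector ω₂) f := by
  unfold cellPairing
  have h1 := integrableOn_currentVector_mul hω hf hN
  have hN' : cellNormSq (fun k => f (-k)) < ⊤ := by rwa [cellNormSq_comp_neg]
  have h2 : IntegrableOn (fun k => currentVector ω₂ k * f (-k)) (Ioc (-π) π) :=
    integrableOn_currentVector_mul hω (f := fun k => f (-k)) (hf.comp measurable_neg) hN'
  have hodd : ∫ k in Ioc (-π) π, (currentVector ω₂ k * f k + currentVector ω₂ k * f (-k)) = 0 := by
    apply integral_cell_eq_zero_of_odd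
    intro k
    simp only [currentVector_odd ω₂ k, neg_neg]
    ring
  rw [integral_add h1 h2] at hodd
  have : (fun k => currentVector ω₂ k * ((f k - f (-k)) / 2)) = fun k =>
      (1 / 2) * (currentVector ω₂ k * f k) - (1 / 2) * (currentVector ω₂ k * f (-k)) := by
    funext k; ring
  rw [this, integral_sub (h1.const_mul _) (h2.const_mul _), integral_const_mul, integral_const_mul]
  linarith

/-! ### 3. The variational bound under the odd-sector gap -/

/-- **Variational bound from the gap.** If `g > 0` is an odd-sector gap constant of `q_{a,b}` then
for every `f` in the form domain `2⟨φ, f⟩ - q(f) ≤ ‖φ‖²/g`, `φ = currentVector ω₂` (odd part,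
`q(f_o) ≤ q(f)`, `g‖f_o‖² ≤ q(f_o)`, and `2φf_o ≤ φ²/g + g f_o²` pointwise).
[cite: AokiLukkarinenSpohn2006, eqs. (4.12)-(4.16)] -/
theorem sub_le_of_gap {ω₂ a b : ℝ} (hω : 0 < ω₂) {g : ℝ} (hg : 0 < g)
    (hgap : ∀ f : ℝ → ℝ, Function.Periodic f (2 * π) → Measurable f → Function.Odd f →
      cellNormSq f < ⊤ → ENNReal.ofReal g * cellNormSq f ≤ boltzmannForm ω₂ a b f)
    {f : ℝ → ℝ} (hf : IsFormDomain ω₂ a b f) :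
    2 * cellPairing (currentVector ω₂) f - (boltzmannForm ω₂ a b f).toReal ≤
      (∫ k in Ioc (-π) π, currentVector ω₂ k ^ 2) / g := by
  have hfo_per : Function.Periodic (fun k => (f k - f (-k)) / 2) (2 * π) :=
    oddPart_periodic hf.periodic
  have hfo_meas : Measurable fun k => (f k - f (-k)) / 2 := by
    have := hf.measurable; fun_prop
  have hfo_odd : Function.Odd fun k => (f k - f (-k)) / 2 := fun k => by
    simp only [neg_neg]; ring
  have hfo_N : cellNormSq (fun k => (f k - f (-k)) / 2) < ⊤ :=
    lt_of_le_of_lt (cellNormSq_oddPart_le hf.measurable) hf.normSq_lt_top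
  have hq : boltzmannForm ω₂ a b (fun k => (f k - f (-k)) / 2) ≤ boltzmannForm ω₂ a b f :=
    boltzmannForm_oddPart_le hω a b hf.periodic hf.measurable
  have hgap' := hgap _ hfo_per hfo_meas hfo_odd hfo_N
  set N := (cellNormSq fun k => (f k - f (-k)) / 2).toReal with hNd
  have hgN : g * N ≤ (boltzmannForm ω₂ a b f).toReal := by
    have h' := ENNReal.toReal_mono hf.form_lt_top.ne (hgap'.trans hq)
    rwa [ENNReal.toReal_mul, ENNReal.toReal_ofReal hg.le] at h'
  have hP := cellPairing_oddPart hω hf.measurable hf.normSq_lt_top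
  -- integrate the pointwise bound `2 φ f_o ≤ φ²/g + g f_o²`
  have hint : 2 * cellPairing (currentVector ω₂) (fun k => (f k - f (-k)) / 2) ≤
      (∫ k in Ioc (-π) π, currentVector ω₂ k ^ 2) / g + g * N := by
    unfold cellPairing
    have hφfo := integrableOn_currentVector_mul hω hfo_meas hfo_N
    have hφ2 : IntegrableOn (fun k => currentVector ω₂ k ^ 2) (Ioc (-π) π) := by
      have hc : Continuous fun k => currentVector ω₂ k ^ 2 := by
        have hd : Continuous fun k => dispersion ω₂ k ^ 2 := by unfold dispersion; fun_prop
        exact (Real.continuous_sin.div hd fun k => (pow_pos (dispersion_pos hω k) 2).ne').pow 2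
      exact hc.integrableOn_Ioc
    have hfo2 : IntegrableOn (fun k => ((f k - f (-k)) / 2) ^ 2) (Ioc (-π) π) := by
      refine ⟨(hfo_meas.pow_const 2).aestronglyMeasurable, ?_⟩
      rw [hasFiniteIntegral_iff_ofReal (ae_of_all _ fun k => sq_nonneg _)]
      exact hfo_N
    have hNeq : ∫ k in Ioc (-π) π, ((f k - f (-k)) / 2) ^ 2 = N := by
      rw [hNd, integral_eq_lintegral_of_nonneg_ae (ae_of_all _ fun k => sq_nonneg _)
        (hfo_meas.pow_const 2).aestronglyMeasurable]
      rfl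
    calc 2 * ∫ k in Ioc (-π) π, currentVector ω₂ k * ((f k - f (-k)) / 2)
        = ∫ k in Ioc (-π) π, 2 * (currentVector ω₂ k * ((f k - f (-k)) / 2)) :=
          (integral_const_mul _ _).symm
      _ ≤ ∫ k in Ioc (-π) π, (currentVector ω₂ k ^ 2 / g + g * ((f k - f (-k)) / 2) ^ 2) := by
          apply integral_mono (hφfo.const_mul 2) ((hφ2.div_const g).add (hfo2.const_mul g))
          intro k
          have hsq := sq_nonneg (g * ((f k - f (-k)) / 2) - currentVector ω₂ k)
          have key : 2 * (currentVector ω₂ k * ((f k - f (-k)) / 2)) * g ≤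
              currentVector ω₂ k ^ 2 + g * ((f k - f (-k)) / 2) ^ 2 * g := by nlinarith
          have : currentVector ω₂ k ^ 2 / g + g * ((f k - f (-k)) / 2) ^ 2 =
              (currentVector ω₂ k ^ 2 + g * ((f k - f (-k)) / 2) ^ 2 * g) / g := by
            field_simp
          show 2 * (currentVector ω₂ k * ((f k - f (-k)) / 2)) ≤
            currentVector ω₂ k ^ 2 / g + g * ((f k - f (-k)) / 2) ^ 2
          rw [this, le_div_iff₀ hg]
          exact key
      _ = (∫ k in Ioc (-π) π, currentVector ω₂ k ^ 2) / g + g * N := by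
          rw [integral_add (hφ2.div_const g) (hfo2.const_mul g), integral_div, integral_const_mul,
            hNeq]
  rw [← hP]
  linarith

/-- **Finiteness of the variational inverse of the current under the odd-sector gap**:
`⟨ω⁻²g, L⁻¹ω⁻²g⟩ ≤ ‖ω⁻²g‖²/g < ∞`. [cite: AokiLukkarinenSpohn2006, eqs. (4.12)-(4.16)] -/
theorem inverseForm_currentVector_lt_top {ω₂ a b : ℝ} (hω : 0 < ω₂)
    (hgap : HasOddSectorGap ω₂ a b) : inverseForm ω₂ a b (currentVector ω₂) < ⊤ := by
  obtain ⟨g, hg, hgap⟩ := hgap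
  unfold inverseForm
  refine lt_of_le_of_lt ?_
    (ENNReal.ofReal_lt_top (r := (∫ k in Ioc (-π) π, currentVector ω₂ k ^ 2) / g))
  exact iSup₂_le fun f hf => ENNReal.ofReal_le_ofReal (sub_le_of_gap hω hg hgap hf)

/-- **Finiteness of the kinetic conductivity under the odd-sector gap** (`ω₂ > 0`).
[cite: AokiLukkarinenSpohn2006, §3 eqs. (3.22)-(3.23)] -/
theorem kineticConductivity_lt_top {ω₂ a b : ℝ} (hω : 0 < ω₂) (hgap : HasOddSectorGap ω₂ a b)
    (T : ℝ) : kineticConductivity ω₂ a b T < ⊤ :=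
  ENNReal.mul_lt_top ENNReal.ofReal_lt_top (inverseForm_currentVector_lt_top hω hgap)

/-! ### 4. The item -/

/-- **`KineticConductivityFinite` (item stmt-AtomisticToContinuum-12599).** For `ω₂, a, b, T > 0`,
an odd-sector gap of ALS's linearised phonon-Boltzmann form makes the kinetic conductivity
`(2πT²)⁻¹⟨ω⁻²g, L⁻¹ω⁻²g⟩` of the pinned chain finite AND positive: positivity from the explicit
form-domain element `sin` (its bracket cancels the Jacobian singularity exactly), finiteness from
parity and the gap. [cite: AokiLukkarinenSpohn2006, §3 eqs. (3.22)-(3.23) and §4 eqs. (4.11)-(4.16)] -/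
theorem kineticConductivityFinite_proof :
    Summit.AtomisticToContinuum.FouriersLaw.Theses.EmbeddedDrudeMourre.KineticConductivityFinite := by
  intro ω₂ a b T hω ha hb hT hgap
  exact ⟨kineticConductivity_pos hω ha.le hb.le hT.ne', kineticConductivity_lt_top hω hgap T⟩

end Summit.AtomisticToContinuum.FouriersLaw.Theorems.KineticConductivityFinite

end
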